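import Mathlib.Analysis.SpecialFunctions.Exp
import Mathlib.Analysis.Convex.SpecificFunctions.Basic
import HarnessLib

/-!
# K1L_D (stmt-AnomalousDissipation-27980), stub `stub_oneLevelL_IW`: two elementary exponential inequalities of the window bookkeeping (S3′ bricks)
# (helper; `--supports … --as helper`)

* `one_sub_exp_ge_min` — `(1 − e^{−2})·min(1, x) ≤ 1 − e^{−2x}` for `x ≥ 0`: the flat modal decay `1 − e^{−2 r_ℓ τ}` over a window dominates the
  ledger's decay weight `d_ℓ = min(1, r_ℓ τ)` (dissipation floor from (E_G) + explicit flat decay);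
* (the burst/leak shape `x·e^{−x} ≤ 1 − e^{−x}`, i.e. `sup_D D e^{−D}/(1 − e^{−D}) ≤ 1` of memo L4 §2, is ALREADY in the tree as
  `Literature.NumberTheory.Automorphic.SelbergDecay.mul_exp_neg_le_one_sub_exp_neg` — reuse it, do not restate.)
Infrastructure for rung F-D1.A0; NOT a proof of the crux or of anomalous dissipation.
-/

set_option linter.dupNamespace false

namespace Summit.AnomalousDissipation.AnomalousDissipation.Theorems.SolenoidalFractalHomogenisation.LagrangianStep

/-- `(1 − e^{−2})·min(1, x) ≤ 1 − e^{−2x}` for `x ≥ 0` (concavity of `x ↦ 1 − e^{−2x}` on `[0,1]`, monotonicity beyond). -/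
theorem one_sub_exp_ge_min {x : ℝ} (hx : 0 ≤ x) : (1 - Real.exp (-2)) * min 1 x ≤ 1 - Real.exp (-2 * x) := by
  rcases le_or_gt x 1 with hx1 | hx1
  · -- chord of the convex function `exp` between `0` and `−2`: `e^{−2x} ≤ (1−x)·e⁰ + x·e^{−2}`
    rw [min_eq_right hx1]
    have hconv := (convexOn_exp).2 (Set.mem_univ (0:ℝ)) (Set.mem_univ (-2:ℝ)) (by linarith : 0 ≤ 1 - x) hx (by ring)
    simp only [smul_eq_mul, mul_zero, zero_add, Real.exp_zero, mul_one] at hconv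
    have : Real.exp (x * -2) = Real.exp (-2 * x) := by rw [mul_comm]
    rw [this] at hconv
    linarith
  · rw [min_eq_left hx1.le, mul_one]
    have : Real.exp (-2 * x) ≤ Real.exp (-2) := Real.exp_le_exp.2 (by linarith)
    linarith

/-- Packaged decay-weight form: for a rate `r ≥ 0` and window length `τ ≥ 0`, `(1 − e^{−2})·min(1, rτ) ≤ 1 − e^{−2rτ}`. -/
theorem decayWeight_le_one_sub_exp {r τ : ℝ} (hr : 0 ≤ r) (hτ : 0 ≤ τ) :
    (1 - Real.exp (-2)) * min 1 (r * τ) ≤ 1 - Real.exp (-(2 * (r * τ))) := by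
  have := one_sub_exp_ge_min (mul_nonneg hr hτ)
  rwa [neg_mul] at this

end Summit.AnomalousDissipation.AnomalousDissipation.Theorems.SolenoidalFractalHomogenisation.LagrangianStep
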